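import Literature.Analysis.FluidPDE.BarkerPrangeConcentration
import Literature.Analysis.FluidPDE.LocalEnergySolutionsRescaling
import Literature.Analysis.FluidPDE.LocalLerayExistence
import HarnessLib

/-!
# Barker–Prange 2020, Theorem 2: the printed proof (§4.2) as a reduction to Theorem 1

Analysis/FluidPDE proof file (theorems only: no definitions, no named facts — D-0026) below the
named fact `Literature.Analysis.FluidPDE.BarkerPrange2020_thm2` (`BarkerPrangeConcentration.lean`;
T. Barker, C. Prange, *Localized smoothing for the Navier–Stokes equations and concentration of
critical norms near singularities*, Arch. Ration. Mech. Anal. 236 (2020) 1487–1541 =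
arXiv:1812.09115, **Theorem 2**: `L³` concentration at the similarity scale near a Type-I
singularity).

## The printed proof and what this file proves

The whole printed proof of Theorem 2 is §4.2 (arXiv p. 16), a rescaling argument reducing it to
the paper's main result, **Theorem 1** (localized smoothing, arXiv p. 2): *"For all `M ∈ (0, ∞)`
there exists `S*(M) ∈ (0, ¼]` and an independent universal constant `γ_univ` such that the
following holds true. Consider any local energy solution `u` ... with initial data
`u₀ ∈ L²_{uloc,σ}(ℝ³)` satisfying `‖u₀‖_{L²_uloc} ≤ M` and
`sup_{|x̄| ≥ R} ‖u₀‖_{L²(B₁(x̄))} → 0` (`R → ∞`), `u₀ ∈ L³(B₂(0))` and `‖u₀‖_{L³(B₂(0))} ≤ γ_univ`.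
Then `u ∈ L^∞(B_{1/3}(0) × (β, S*(M)))` for all `β ∈ (0, S*(M))`."* §4.2: *"The proof of
Theorem 2 is by contradiction. ... Let `t_*(T*, M, r₀) := T* - S*(M) r₀²`. Assume that there
exists a Leray–Hopf solution `u` satisfying the type I bound (1.7) such that `u` blows-up at
`(0, T*)` and there exists `t₀ ∈ (t_*, T*)` such that `‖u(·, t₀)‖_{L³(|·| ≤ 2√((T*-t₀)/S*(M)))} ≤ γ_univ`.
We then rescale, `λ := √((T* - t₀)/S*(M))`, `u_λ(y, s) := λ u(λ y, t₀ + λ² s)`. Then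
`‖u_λ(·, 0)‖_{L³(|·| ≤ 2)} ≤ γ_univ`. Furthermore, since `S*(M) ≤ 1` and by our choice of `t_*`,
we can take `r = λ ≤ r₀` and `t = t₀` in (1.7). Therefore `‖u_λ(·, 0)‖_{L²_uloc} ≤ M`. Theorem 1
enables to conclude that `u_λ` is regular at the space–time point `(0, S*(M))`, which is a
contradiction."*

This file formalises exactly this argument, for the tree's transcription (every viscosity
`ν > 0`, every blow-up point `x₀`; module docstring of `BarkerPrangeConcentration.lean`): the
rescaled field is `v(s, y) = (λ/ν) u(t₀ + λ² s/ν, x₀ + λ y)` =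
`(λ/ν) • stPull (λ²/ν) λ t₀ x₀ u` with `λ² = ν (T - t₀)/S`, a unit-viscosity field whose time
`s = S` is the blow-up time `T` (`SpaceTimeRescaling.lean`). Two inputs of the printed proof are
not in the tree and are taken as **hypotheses written out inline** (no named fact is introduced;
the same discipline as `AlbrittonSingularPointReduction.lean`):

* `hT1` — **Theorem 1 of the paper**, in the form in which §4.2 uses it: for local energy
  solutions on the finite strip `ℝ³ × (0, S*(M))` (the tree's `IsLocalEnergySolutionOn`, Seregin
  2014 Def. B.1 = Kikuchi–Seregin = Kang–Miura–Tsai 2021 Def. 3.1, the class of the paper's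
  Definition 16 restricted to `(0, S*(M))`; the proof of Theorem 1, §§2–4, only ever uses the
  solution before the time `S*(M)`), with datum in `E²` (`MemE2`: `L²_uloc` and vanishing at
  infinity, the paper's two displayed conditions), `‖u₀‖_{L²(B₁(x̄))} ≤ M` for all `x̄`, and
  `‖u₀‖_{L³(B₂(0))} ≤ γ`; conclusion `u ∈ L^∞((β, S) × B_{1/3}(0))` for every `β ∈ (0, S)`.
  The divergence-free condition on the datum printed in Theorem 1 (`u₀ ∈ L²_{uloc,σ}`) is
  automatic for the datum of a local energy solution (tree:
  `IsLocalEnergySolutionOn.isWeaklyDivFree_datum`), so it is not repeated. This is the paper's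
  main theorem (its proof is §§2–4: a Caffarelli–Kohn–Nirenberg iteration for the critically
  perturbed system, Theorem 3's bootstrap, Kato's `L³` mild solutions with `L⁵` bounds and the
  Jia–Šverák a-priori estimate) = Kang–Miura–Tsai, IMRN 2021 (arXiv:1812.10509), Thm. 1.1 /
  Cor. 1.2; it is not in the tree.
* `hLE` — the step the printed proof leaves implicit when it applies Theorem 1 to `u_λ` ("`u_λ`
  is a local energy solution with initial data `u_λ(·, 0)`"): for a global Leray–Hopf solution
  `u` (tree: `IsGlobalLerayHopf ν 0 u₀ u`) all of whose points in the open strip `0 < t < T`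
  are regular, the restarted field `s ↦ u(t₀ + s)`, `0 < t₀ < T`, is (with some pressure) a
  local energy solution on `ℝ³ × (0, T - t₀)` with datum `u(t₀)` (local energy inequality and
  local `L²`-continuity at `t₀` from the interior regularity of locally bounded weak solutions,
  the associated pressure `p = R_i R_j(u_i u_j)`, the uniformly local bounds and the decay from
  the global energy inequality, weak continuity on the closed interval `[t₀, T]` from the
  Leray–Hopf class). The recentring at `x₀`, the Navier–Stokes rescaling by `λ` and the
  normalisation of the viscosity are then supplied by the proved covariance
  `IsLocalEnergySolutionOn.stRescale` (`LocalEnergySolutionsRescaling.lean`).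

Proved here:

* `BarkerPrange2020_thm2_of_localizedSmoothing : hT1 → hLE → BarkerPrange2020_thm2` — §4.2 as
  printed: `t_* = max(0, T - S r₀²/ν)` (`= 0` for `r₀ = ∞`); if `‖u(t₀)‖_{L³(B̄(x₀, 2λ))} ≤ γ ν`
  for some `t₀ ∈ (t_*, T)`, the datum of the rescaled solution has `‖v₀‖_{L³(B₂)} ≤ γ`
  (change of variables) and `‖v₀‖_{L²(B₁(x̄))} ≤ M` for every `x̄` (the Type-I bound at radius
  `r = λ < r₀`, admissible since `S < 1` gives `T - λ²/ν < t₀`), and lies in `E²` (it is in `L²`);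
  `hT1` bounds `v` on `(S/2, S) × B_{1/3}(0)`, i.e. `u` on `(t₀ + (T - t₀)/2, T) × B_{λ/3}(x₀)`
  (essential suprema are invariant under the affine bijection), which contains the backward
  cylinder `Q_r(T, x₀)`, `r = min(λ/3, √((T - t₀)/2))` — contradicting the singularity of
  `(T, x₀)`.
* the elementary changes of variables it needs (`eLpNorm_comp_add_smul_ball`,
  `eLpNorm_top_uncurry_smul_stPull_preimage`, `memLp_comp_add_smul`, and the Jacobian constants
  `ofReal_inv_cube_rpow_half`, `ofReal_inv_cube_rpow_third`).

What remains below `BarkerPrange2020_thm2` after this file: the two hypotheses — `hT1` (the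
paper's Theorem 1, theory-sized) and `hLE` (standard; the tree has the ingredients
`isSuitableWeakSolutionOn_of_bounded`, `IsSuitableWeakSolutionOn.of_exhaustion`,
`IsLerayHopfOn.exists_hasWeakSpatialGradientOn`, `LerayHopfRestartEverywhere`,
`NSBoundedInteriorRegularity`).

## Mathlib / tree search

Tree: `BarkerPrange2020_thm2`, `IsGlobalLerayHopf`, `IsRegularPoint`, `parabolicCylinder`,
`IsLocalEnergySolutionOn`, `IsLocalEnergySolutionOn.stRescale`, `MemE2`, `memE2_of_memLp`,
`stPull`, `stAffine`, `stAffine_preimage_cylinder`, `map_stAffine_volume_restrict_preimage`,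
`measurableEmbedding_stAffine`, `spaceAffineHomeomorph`, `map_space_affine_volume`
(`lean search 'BarkerPrange|LocalSmoothing|shortTime|KangMiuraTsai2020, Thm'`: no localized
smoothing statement in the tree; `knss2009_local_smoothing` is the unrelated bounded-data mild
smoothing). Mathlib: `eLpNorm_const_smul`, `MeasurableEmbedding.eLpNorm_map_measure`,
`MeasurableEmbedding.memLp_map_measure_iff`, `eLpNorm_smul_measure_of_ne_top`,
`eLpNormEssSup_mono_measure`, `ENNReal.mul_lt_top_iff`, `Real.pow_rpow_inv_natCast`.

## References

* T. Barker, C. Prange, Arch. Ration. Mech. Anal. 236 (2020) 1487–1541,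
  doi:10.1007/s00205-020-01495-6 = arXiv:1812.09115 (held, `paper:arxiv-1812.09115`): Thm. 1
  (p. 2), (1.7) and Thm. 2 (pp. 4–5), §4.2 (p. 16), Def. 16 and Prop. 17 (p. 17).
  [BarkerPrange2020]
* K. Kang, H. Miura, T.-P. Tsai, IMRN 2021 = arXiv:1812.10509 (held), Thm. 1.1, Cor. 1.2,
  Def. 3.1. [KangMiuraTsai2020]
* G. Seregin, *Lecture Notes on Regularity Theory for the Navier–Stokes Equations* (2014),
  App. B, Def. B.1. [Seregin2014]
-/

noncomputable section

open MeasureTheory Set Function Filter Metric Topology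
open scoped ENNReal NNReal

namespace Literature.Analysis.FluidPDE

/-! ### Changes of variables -/

/-- **`L^p` norms on balls under `y ↦ x₀ + λ y`** (`λ > 0`, `p < ∞`):
`‖F(x₀ + λ ·)‖_{L^p(B(x̄, R))} = (λ⁻³)^{1/p} ‖F‖_{L^p(B(x₀ + λ x̄, λ R))}` (Lebesgue measure on
`ℝ³` scales by `λ³`, and the affine map sends `B(x̄, R)` onto `B(x₀ + λ x̄, λ R)`). No
measurability of `F` is needed. [folklore] -/
theorem eLpNorm_comp_add_smul_ball {F' : Type*} [NormedAddCommGroup F'] (F : (EuclideanSpace ℝ (Fin 3)) → F')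
    (x₀ x₁ : (EuclideanSpace ℝ (Fin 3))) {l : ℝ} (hl : 0 < l) (R : ℝ) {p : ℝ≥0∞} (hp : p ≠ ∞) :
    eLpNorm (fun y => F (x₀ + l • y)) p (volume.restrict (ball x₁ R)) =
      ENNReal.ofReal ((l ^ 3)⁻¹) ^ (1 / p).toReal *
        eLpNorm F p (volume.restrict (ball (x₀ + l • x₁) (l * R))) := by
  set e := spaceAffineHomeomorph hl.ne' x₀ with he
  have hme : MeasurableEmbedding e := e.measurableEmbedding
  have hcoe : (e : (EuclideanSpace ℝ (Fin 3)) → (EuclideanSpace ℝ (Fin 3))) = fun y => x₀ + l • y := rfl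
  have hpre : (fun y : (EuclideanSpace ℝ (Fin 3)) => x₀ + l • y) ⁻¹' ball (x₀ + l • x₁) (l * R) = ball x₁ R := by
    ext y
    simp only [mem_preimage, mem_ball, dist_eq_norm]
    have e1 : x₀ + l • y - (x₀ + l • x₁) = l • (y - x₁) := by
      rw [smul_sub]; abel
    rw [e1, norm_smul, Real.norm_eq_abs, abs_of_pos hl]
    exact ⟨fun h => lt_of_mul_lt_mul_left h hl.le, fun h => mul_lt_mul_of_pos_left h hl⟩
  have h1 := hme.restrict_map (volume : Measure (EuclideanSpace ℝ (Fin 3))) (ball (x₀ + l • x₁) (l * R))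
  have h2 := hme.eLpNorm_map_measure (g := F) (p := p)
    (μ := volume.restrict (e ⁻¹' ball (x₀ + l • x₁) (l * R)))
  rw [hcoe] at h1 h2
  rw [hpre] at h1 h2
  rw [show (fun y => F (x₀ + l • y)) = F ∘ fun y => x₀ + l • y from rfl, ← h2, ← h1,
    map_space_affine_volume hl x₀, finrank_euclideanSpace_fin, Measure.restrict_smul,
    eLpNorm_smul_measure_of_ne_top hp, smul_eq_mul]

/-- **`L^p(ℝ³)` is invariant under `y ↦ x₀ + λ y`** (`λ > 0`): the push-forward of Lebesgue
measure is a finite multiple of Lebesgue measure. [folklore] -/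
theorem memLp_comp_add_smul {F' : Type*} [NormedAddCommGroup F'] {F : (EuclideanSpace ℝ (Fin 3)) → F'} {p : ℝ≥0∞}
    (hF : MemLp F p volume) (x₀ : (EuclideanSpace ℝ (Fin 3))) {l : ℝ} (hl : 0 < l) :
    MemLp (fun y => F (x₀ + l • y)) p volume := by
  set e := spaceAffineHomeomorph hl.ne' x₀ with he
  have hme : MeasurableEmbedding e := e.measurableEmbedding
  have hcoe : (e : (EuclideanSpace ℝ (Fin 3)) → (EuclideanSpace ℝ (Fin 3))) = fun y => x₀ + l • y := rfl
  have key : MemLp F p (Measure.map e volume) := by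
    rw [hcoe, map_space_affine_volume hl x₀]
    exact hF.smul_measure ENNReal.ofReal_ne_top
  have h := hme.memLp_map_measure_iff.1 key
  rw [hcoe] at h
  exact h

/-- **Essential suprema under the space–time rescaling**: for `Φ = stAffine β γ t₀ x₀`
(`β, γ > 0`) and any set `S`, `ess sup_{Φ⁻¹(S)} ‖α u ∘ Φ‖ = |α| · ess sup_S ‖u‖` (`Φ` is a
measurable bijection mapping Lebesgue measure on `Φ⁻¹(S)` to a positive multiple of Lebesgue
measure on `S`, and essential suprema only see null sets). [folklore] -/
theorem eLpNorm_top_uncurry_smul_stPull_preimage {β γ : ℝ} (hβ : 0 < β) (hγ : 0 < γ)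
    (t₀ : ℝ) (x₀ : (EuclideanSpace ℝ (Fin 3))) (α : ℝ) (u : ℝ → (EuclideanSpace ℝ (Fin 3)) → (EuclideanSpace ℝ (Fin 3))) (S : Set (ℝ × (EuclideanSpace ℝ (Fin 3)))) :
    eLpNorm (uncurry (α • stPull β γ t₀ x₀ u)) ∞ (volume.restrict (stAffine β γ t₀ x₀ ⁻¹' S)) =
      ‖α‖ₑ * eLpNorm (uncurry u) ∞ (volume.restrict S) := by
  have h1 : uncurry (α • stPull β γ t₀ x₀ u) = α • (uncurry u ∘ stAffine β γ t₀ x₀) := by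
    funext z
    rfl
  rw [h1, eLpNorm_const_smul]
  congr 1
  rw [← (measurableEmbedding_stAffine hβ.ne' hγ.ne' t₀ x₀).eLpNorm_map_measure,
    map_stAffine_volume_restrict_preimage hβ hγ, eLpNorm_exponent_top, eLpNorm_exponent_top]
  have hk : ENNReal.ofReal (β * γ ^ Module.finrank ℝ (EuclideanSpace ℝ (Fin 3)))⁻¹ ≠ 0 :=
    (ENNReal.ofReal_pos.2 (by positivity)).ne'
  refine le_antisymm (eLpNormEssSup_mono_measure _ Measure.smul_absolutelyContinuous)
    (eLpNormEssSup_mono_measure _ fun s hs => ?_)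
  simp only [Measure.smul_apply, smul_eq_mul, mul_eq_zero] at hs
  exact hs.resolve_left hk

/-- The Jacobian constant of `y ↦ x₀ + λ y` in `L²(ℝ³)`: `(λ⁻³)^{1/2} = (√λ)⁻³`. [folklore] -/
theorem ofReal_inv_cube_rpow_half {l : ℝ} (hl : 0 < l) :
    ENNReal.ofReal ((l ^ 3)⁻¹) ^ (1 / (2 : ℝ≥0∞)).toReal =
      ENNReal.ofReal ((Real.sqrt l ^ 3)⁻¹) := by
  have hs0 : 0 < Real.sqrt l := Real.sqrt_pos.2 hl
  have hsq : Real.sqrt l ^ 2 = l := Real.sq_sqrt hl.le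
  rw [one_div, ENNReal.toReal_inv, ENNReal.toReal_ofNat,
    ENNReal.ofReal_rpow_of_nonneg (by positivity) (by positivity)]
  congr 1
  have h3 : (Real.sqrt l ^ 3) ^ 2 = l ^ 3 := by
    calc (Real.sqrt l ^ 3) ^ 2 = (Real.sqrt l ^ 2) ^ 3 := by ring
      _ = l ^ 3 := by rw [hsq]
  rw [← h3, Real.inv_rpow (by positivity), ← Real.rpow_natCast (Real.sqrt l ^ 3) 2,
    ← Real.rpow_mul (by positivity)]
  norm_num

/-- The Jacobian constant of `y ↦ x₀ + λ y` in `L³(ℝ³)`: `(λ⁻³)^{1/3} = λ⁻¹`. [folklore] -/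
theorem ofReal_inv_cube_rpow_third {l : ℝ} (hl : 0 < l) :
    ENNReal.ofReal ((l ^ 3)⁻¹) ^ (1 / (3 : ℝ≥0∞)).toReal = ENNReal.ofReal l⁻¹ := by
  rw [one_div, ENNReal.toReal_inv, ENNReal.toReal_ofNat,
    ENNReal.ofReal_rpow_of_nonneg (by positivity) (by positivity)]
  congr 1
  rw [Real.inv_rpow (by positivity), ← Real.rpow_natCast l 3, ← Real.rpow_mul hl.le]
  norm_num

/-! ### Theorem 2 from Theorem 1 (§4.2) -/

/-- **Barker–Prange 2020, Theorem 2 from Theorem 1: the printed proof (§4.2, arXiv:1812.09115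
p. 16).** Hypotheses, written out inline (module docstring): `hT1` — the paper's **Theorem 1**
(localized smoothing) for local energy solutions on the strip `ℝ³ × (0, S*(M))`
(`IsLocalEnergySolutionOn S 1 v₀ v π`) with datum in `E²` (`MemE2`),
`‖v₀‖_{L²(B₁(x̄))} ≤ M` and `‖v₀‖_{L³(B₂(0))} ≤ γ`: `v ∈ L^∞((β, S) × B_{1/3}(0))` for all
`β ∈ (0, S)`, `S = S*(M) ∈ (0, ¼]`, `γ = γ_univ`; `hLE` — a global Leray–Hopf solution `u`,
regular at every point of the open strip `0 < t < T`, restarts at every `t₀ ∈ (0, T)` as a local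
energy solution `s ↦ u(t₀ + s)` on `ℝ³ × (0, T - t₀)` with datum `u(t₀)` (for some pressure).
Proof as printed: the rescaled pair `v(s, y) = (λ/ν) u(t₀ + λ² s/ν, x₀ + λ y)` is a
unit-viscosity local energy solution on `(0, S)` with datum `v₀ = (λ/ν) u(t₀, x₀ + λ ·)`
(`IsLocalEnergySolutionOn.stRescale`); with
`t_* = max(0, T - S r₀²/ν)` (`0` if `r₀ = ∞`), suppose `‖u(t₀)‖_{L³(B̄(x₀, 2λ))} ≤ γ ν` for some
`t₀ ∈ (t_*, T)`, `λ = √(ν(T - t₀)/S)`. The rescaled datum has `‖v₀‖_{L³(B₂(0))} ≤ γ` and, by the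
Type-I bound at radius `r = λ` (`λ < r₀` by the choice of `t_*`; the time window
`T - λ²/ν < t₀` because `S < 1`), `‖v₀‖_{L²(B₁(x̄))} ≤ M` for every `x̄`; it is in `E²` since
`u(t₀) ∈ L²`. By `hT1`, `v ∈ L^∞((S/2, S) × B_{1/3}(0))`, i.e. `u` is essentially bounded on
`(t₀ + (T - t₀)/2, T) × B_{λ/3}(x₀)` ("`u_λ` is regular at `(0, S*(M))`"), which contains the
backward cylinder `Q_r(T, x₀)`, `r = min(λ/3, √((T - t₀)/2))`, `r² < T` — contradicting the
singularity of `(T, x₀)`.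
[cite: BarkerPrange2020, Thm. 2 and its proof §4.2 (arXiv:1812.09115 pp. 4–5, 16), with Thm. 1 (p. 2)] -/
theorem BarkerPrange2020_thm2_of_localizedSmoothing
    (hT1 : ∃ γ : ℝ, 0 < γ ∧ ∀ M : ℝ, 0 < M → ∃ S : ℝ, 0 < S ∧ S ≤ 1 / 4 ∧
      ∀ (v₀ : (EuclideanSpace ℝ (Fin 3)) → (EuclideanSpace ℝ (Fin 3))) (v : ℝ → (EuclideanSpace ℝ (Fin 3)) → (EuclideanSpace ℝ (Fin 3))) (π : ℝ → (EuclideanSpace ℝ (Fin 3)) → ℝ),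
        IsLocalEnergySolutionOn S 1 v₀ v π → MemE2 v₀ →
        (∀ x₁ : (EuclideanSpace ℝ (Fin 3)), eLpNorm v₀ 2 (volume.restrict (ball x₁ 1)) ≤ ENNReal.ofReal M) →
        eLpNorm v₀ 3 (volume.restrict (ball (0 : (EuclideanSpace ℝ (Fin 3))) 2)) ≤ ENNReal.ofReal γ →
        ∀ β ∈ Ioo 0 S,
          eLpNorm (uncurry v) ∞ (volume.restrict (Ioo β S ×ˢ ball (0 : (EuclideanSpace ℝ (Fin 3))) (1 / 3))) < ∞)
    (hLE : ∀ (ν : ℝ), 0 < ν → ∀ (u₀ : EuclideanSpace ℝ (Fin 3) → EuclideanSpace ℝ (Fin 3))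
      (u : ℝ → EuclideanSpace ℝ (Fin 3) → EuclideanSpace ℝ (Fin 3)), IsGlobalLerayHopf ν 0 u₀ u →
      ∀ (T : ℝ), 0 < T →
      (∀ t ∈ Ioo 0 T, ∀ x : EuclideanSpace ℝ (Fin 3), IsRegularPoint u (t, x)) →
      ∀ t ∈ Ioo 0 T, ∃ π : ℝ → EuclideanSpace ℝ (Fin 3) → ℝ,
        IsLocalEnergySolutionOn (T - t) ν (u t) (fun s => u (t + s)) π) :
    BarkerPrange2020_thm2 := by
  obtain ⟨γ, hγ, hT1⟩ := hT1
  refine ⟨γ, hγ, fun M hM => ?_⟩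
  obtain ⟨S, hS, hS4, hsm⟩ := hT1 M hM
  refine ⟨S, hS, hS4, fun ν T hν hT r₀ hr₀ => ?_⟩
  have hS1 : S < 1 := by linarith
  -- the time `t_*`
  set tStar : ℝ := if r₀ = ∞ then 0 else max 0 (T - S * r₀.toReal ^ 2 / ν) with htStar_def
  have htStar0 : 0 ≤ tStar := by
    rw [htStar_def]
    split_ifs
    · exact le_rfl
    · exact le_max_left _ _
  have htStarT : tStar < T := by
    rw [htStar_def]
    split_ifs with h
    · exact hT
    · have hr : 0 < r₀.toReal := ENNReal.toReal_pos hr₀.ne' h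
      have : 0 < S * r₀.toReal ^ 2 / ν := by positivity
      exact max_lt hT (by linarith)
  refine ⟨tStar, htStar0, htStarT, fun h => by rw [htStar_def, if_pos h], ?_⟩
  intro u₀ u hLH hTypeI hReg x₀ hSing t ht
  have ht0 : 0 < t := lt_of_le_of_lt htStar0 ht.1
  have htT : t < T := ht.2
  have hTt : 0 < T - t := sub_pos.2 htT
  by_contra hcon
  rw [not_lt] at hcon
  -- the similarity scale `λ`, `λ² = ν (T - t) / S`
  have hpos : 0 < ν * (T - t) / S := div_pos (mul_pos hν hTt) hS
  obtain ⟨l, hl_def, hl, hl2⟩ :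
      ∃ l : ℝ, l = Real.sqrt (ν * (T - t) / S) ∧ 0 < l ∧ l ^ 2 = ν * (T - t) / S :=
    ⟨_, rfl, Real.sqrt_pos.2 hpos, Real.sq_sqrt hpos.le⟩
  rw [← hl_def] at hcon
  have hν0 : ν ≠ 0 := hν.ne'
  have hS0 : S ≠ 0 := hS.ne'
  have hl0 : l ≠ 0 := hl.ne'
  have hTt0 : T - t ≠ 0 := hTt.ne'
  have hβ : 0 < l ^ 2 / ν := by positivity
  have hl2ν : l ^ 2 / ν = (T - t) / S := by
    rw [hl2]; field_simp
  -- `λ < r₀` (the choice of `t_*`)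
  have hlr₀ : ENNReal.ofReal l < r₀ := by
    by_cases hinf : r₀ = ∞
    · rw [hinf]; exact ENNReal.ofReal_lt_top
    · have hr : 0 < r₀.toReal := ENNReal.toReal_pos hr₀.ne' hinf
      have htS : T - S * r₀.toReal ^ 2 / ν ≤ tStar := by
        rw [htStar_def, if_neg hinf]; exact le_max_right _ _
      have h1 : T - t < S * r₀.toReal ^ 2 / ν := by linarith [ht.1]
      have h2 : ν * (T - t) / S < r₀.toReal ^ 2 := by
        rw [lt_div_iff₀ hν] at h1
        rw [div_lt_iff₀ hS]
        nlinarith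
      have h3 : l < r₀.toReal := by
        rw [← Real.sqrt_sq hr.le, hl_def]
        exact Real.sqrt_lt_sqrt hpos.le h2
      calc ENNReal.ofReal l < ENNReal.ofReal r₀.toReal := (ENNReal.ofReal_lt_ofReal_iff hr).2 h3
        _ = r₀ := ENNReal.ofReal_toReal hinf
  -- the time window of the Type-I bound at radius `λ`: `T - λ²/ν < t` since `S < 1`
  have hwin : T - l ^ 2 / ν < t := by
    rw [hl2ν]
    have h1 : (T - t) * S < T - t := mul_lt_of_lt_one_right hTt hS1
    have h2 : T - t < (T - t) / S := (lt_div_iff₀ hS).2 h1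
    linarith
  -- the restarted solution, and the rescaled local energy solution of §4.2
  obtain ⟨π, hπ⟩ := hLE ν hν u₀ u hLH T hT hReg t ⟨ht0, htT⟩
  have hβeq : l ^ 2 / ν = l / ν * l := by
    rw [sq]; ring
  have hv := hπ.stRescale (div_pos hl hν) hl hβeq x₀
  have hslab : (T - t) / (l ^ 2 / ν) = S := by
    rw [hl2]; field_simp
  have hvisc : l / ν * ν / l = 1 := by
    field_simp
  have hfun : ((l / ν) • stPull (l ^ 2 / ν) l 0 x₀ fun s => u (t + s)) =
      (l / ν) • stPull (l ^ 2 / ν) l t x₀ u := by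
    funext s y
    simp only [smul_stPull_apply, zero_add]
  rw [hslab, hvisc, hfun] at hv
  -- its datum: in `L²`, hence in `E²`
  have hut : MemLp (u t) 2 volume := (hLH T hT).memLp t ⟨ht0.le, htT.le⟩
  have hv₀2 : MemLp (fun y => (l / ν) • u t (x₀ + l • y)) 2 volume :=
    (memLp_comp_add_smul hut x₀ hl).const_smul (l / ν)
  have hE2 : MemE2 (fun y => (l / ν) • u t (x₀ + l • y)) :=
    memE2_of_memLp hv₀2 le_rfl (by norm_num)
  have hsmul : ∀ q : ℝ≥0∞, ∀ μ : Measure (EuclideanSpace ℝ (Fin 3)),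
      eLpNorm (fun y => (l / ν) • u t (x₀ + l • y)) q μ =
        ‖l / ν‖ₑ * eLpNorm (fun y => u t (x₀ + l • y)) q μ := fun q μ => by
    rw [show (fun y => (l / ν) • u t (x₀ + l • y)) = (l / ν) • fun y => u t (x₀ + l • y)
      from rfl, eLpNorm_const_smul]
  have hlν : ‖l / ν‖ₑ = ENNReal.ofReal (l / ν) := Real.enorm_eq_ofReal (by positivity)
  -- `‖v₀‖_{L²(B₁(x̄))} ≤ M` from the Type-I bound at radius `λ`
  have hL2 : ∀ x₁ : (EuclideanSpace ℝ (Fin 3)), eLpNorm (fun y => (l / ν) • u t (x₀ + l • y)) 2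
      (volume.restrict (ball x₁ 1)) ≤ ENNReal.ofReal M := by
    intro x₁
    have hTI := hTypeI (x₀ + l • x₁) l hl hlr₀ t ht0 hwin htT
    have hsl : l * Real.sqrt l = Real.sqrt l ^ 3 := by
      calc l * Real.sqrt l = Real.sqrt l ^ 2 * Real.sqrt l := by rw [Real.sq_sqrt hl.le]
        _ = Real.sqrt l ^ 3 := by ring
    have hs0 : 0 < Real.sqrt l := Real.sqrt_pos.2 hl
    calc eLpNorm (fun y => (l / ν) • u t (x₀ + l • y)) 2 (volume.restrict (ball x₁ 1))
        = ‖l / ν‖ₑ * (ENNReal.ofReal ((l ^ 3)⁻¹) ^ (1 / (2 : ℝ≥0∞)).toReal *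
            eLpNorm (u t) 2 (volume.restrict (ball (x₀ + l • x₁) (l * 1)))) := by
          rw [hsmul, eLpNorm_comp_add_smul_ball (u t) x₀ x₁ hl 1 (by norm_num)]
      _ ≤ ‖l / ν‖ₑ * (ENNReal.ofReal ((Real.sqrt l ^ 3)⁻¹) *
            ENNReal.ofReal (M * ν * Real.sqrt l)) := by
          rw [ofReal_inv_cube_rpow_half hl, mul_one]
          gcongr
      _ = ENNReal.ofReal M := by
          rw [hlν, ← ENNReal.ofReal_mul (by positivity), ← ENNReal.ofReal_mul (by positivity)]
          congr 1
          rw [← hsl]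
          field_simp
  -- `‖v₀‖_{L³(B₂(0))} ≤ γ` from the assumed smallness at time `t`
  have hL3 : eLpNorm (fun y => (l / ν) • u t (x₀ + l • y)) 3
      (volume.restrict (ball (0 : (EuclideanSpace ℝ (Fin 3))) 2)) ≤ ENNReal.ofReal γ := by
    have h1 : eLpNorm (u t) 3 (volume.restrict (ball x₀ (2 * l))) ≤ ENNReal.ofReal (γ * ν) :=
      (eLpNorm_mono_measure _ (Measure.restrict_mono ball_subset_closedBall le_rfl)).trans hcon
    calc eLpNorm (fun y => (l / ν) • u t (x₀ + l • y)) 3 (volume.restrict (ball (0 : (EuclideanSpace ℝ (Fin 3))) 2))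
        = ‖l / ν‖ₑ * (ENNReal.ofReal ((l ^ 3)⁻¹) ^ (1 / (3 : ℝ≥0∞)).toReal *
            eLpNorm (u t) 3 (volume.restrict (ball (x₀ + l • (0 : (EuclideanSpace ℝ (Fin 3)))) (l * 2)))) := by
          rw [hsmul, eLpNorm_comp_add_smul_ball (u t) x₀ 0 hl 2 (by norm_num)]
      _ ≤ ‖l / ν‖ₑ * (ENNReal.ofReal l⁻¹ * ENNReal.ofReal (γ * ν)) := by
          rw [ofReal_inv_cube_rpow_third hl, smul_zero, add_zero, mul_comm l 2]
          gcongr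
      _ = ENNReal.ofReal γ := by
          rw [hlν, ← ENNReal.ofReal_mul (by positivity), ← ENNReal.ofReal_mul (by positivity)]
          congr 1
          field_simp
  -- Theorem 1: the rescaled solution is bounded on `(S/2, S) × B_{1/3}(0)`
  have hbdd := hsm _ _ _ hv hE2 hL2 hL3 (S / 2) ⟨by linarith, by linarith⟩
  -- back to `u`: bounded on `(t + (T - t)/2, T) × B_{λ/3}(x₀)`
  have hpre : stAffine (l ^ 2 / ν) l t x₀ ⁻¹' (Ioo (t + (T - t) / 2) T ×ˢ ball x₀ (l / 3)) =
      Ioo (S / 2) S ×ˢ ball (0 : (EuclideanSpace ℝ (Fin 3))) (1 / 3) := by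
    rw [stAffine_preimage_cylinder hβ hl, hl2ν, sub_self, smul_zero]
    congr 1
    · congr 1
      · field_simp
        ring
      · field_simp
    · congr 1
      field_simp
  have hbdd' : eLpNorm (uncurry u) ∞
      (volume.restrict (Ioo (t + (T - t) / 2) T ×ˢ ball x₀ (l / 3))) < ∞ := by
    rw [← hpre, eLpNorm_top_uncurry_smul_stPull_preimage hβ hl] at hbdd
    rcases ENNReal.mul_lt_top_iff.1 hbdd with (⟨-, h⟩ | h | h)
    · exact h
    · exact absurd h (by simp [hl0, hν0])
    · rw [h]; exact ENNReal.zero_lt_top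
  -- a backward cylinder at `(T, x₀)` inside that box
  set r : ℝ := min (l / 3) (Real.sqrt ((T - t) / 2)) with hr_def
  have hr : 0 < r := lt_min (by positivity) (Real.sqrt_pos.2 (by positivity))
  have hr2 : r ^ 2 ≤ (T - t) / 2 := by
    have h1 : r ≤ Real.sqrt ((T - t) / 2) := min_le_right _ _
    have h2 : r ^ 2 ≤ Real.sqrt ((T - t) / 2) ^ 2 := pow_le_pow_left₀ hr.le h1 2
    rwa [Real.sq_sqrt (by positivity)] at h2
  have hrT : r ^ 2 < T := by linarith
  have hsub : parabolicCylinder r ((T : ℝ), x₀) ⊆ Ioo (t + (T - t) / 2) T ×ˢ ball x₀ (l / 3) := by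
    rintro ⟨s, y⟩ hz
    rw [mem_parabolicCylinder] at hz
    exact ⟨⟨by linarith [hz.1.1], hz.1.2⟩, mem_ball.2 (lt_of_lt_of_le hz.2 (min_le_left _ _))⟩
  have hlt : eLpNorm (uncurry u) ∞ (volume.restrict (parabolicCylinder r ((T : ℝ), x₀))) < ∞ :=
    (eLpNorm_mono_measure _ (Measure.restrict_mono hsub le_rfl)).trans_lt hbdd'
  exact hlt.ne (hSing r hr hrT)

end Literature.Analysis.FluidPDE

end
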